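import Literature.Topology.FourManifolds.SubsphereDiscs
import Literature.Topology.FourManifolds.SchoenfliesTools
import Literature.Topology.FourManifolds.SphereCircleSplitting
import Literature.Topology.FourManifolds.ClosedBallSmoothEmbeddings
import Literature.Topology.FourManifolds.CerfGammaFourProofs
import Literature.Topology.FourManifolds.DehnSurgeryRotationField
import HarnessLib

/-!
# The sub-sphere of the capped-ball step is a smoothly embedded `2`-sphere

Topic `Literature/Topology/FourManifolds`; fact seat of Alexander's theorem
(`provefact-Literature.Topology.FourManifolds.SphereEmbedding.schoenflies_exists_ball`, Schultens
(2014), Thm. 3.2.5).  **Everything in this file is proved; no definitions, no named facts.**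

`CappedBallLid.exists_subsphereParam` — given the filled sphere `f : 𝕊² → ℝ³` (a smooth
embedding with range `{F₂ = 0}`), **there is a smooth embedding `f_B : 𝕊² → ℝ³` with range the
sub-sphere `W = subSphere F P E₁ s δ ε₀`**: the smooth sphere `S₁` of the printed proof
("we isotope `S₁` … slightly … to be smooth", Schultens (2014), proof of Thm. 3.2.5, PDF p. 45)
exists as a `SphereEmbedding`-grade object.  Proof: `W` is the regular level of `G_B`
(`isRegularLevel_subFun`), a compact smooth surface (§1: maps into it are handled through
`ℝ³`); it is covered by two smoothly embedded closed discs meeting exactly along the circle `β_c`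
(§2 `exists_circleParam`) — the dome disc (§3 `exists_domeDiscEmb`, an explicit graph, after a
radial squash `exists_squash` of the plane) and the disc `D_A = W ∖ V`, which is the image of one
of the two discs into which `f⁻¹(β_c)` cuts `𝕊²` (`SphereCircleSplitting.exists_two_discs`,
identified by a connectedness argument `image_disc_eq`, lifted by `exists_levelDiscEmb`) — hence
a twisted sphere, diffeomorphic to `𝕊²` (`SchoenfliesTools.nonempty_diffeomorph_sphere_two`).

## References
* J. Schultens, *Introduction to 3-Manifolds*, GSM 151, AMS (2014), Thm. 3.2.5, PDF pp. 42–45.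
* J. Milnor, *Lectures on the h-cobordism theorem*, Princeton (1965), §9.
* M. W. Hirsch, *Differential Topology*, Springer GTM 33 (1976), Ch. 1 §3, Ch. 8.
-/

open scoped RealInnerProductSpace Topology Manifold ContDiff
open Set Filter Metric Function

noncomputable section

namespace Literature.Topology.FourManifolds

namespace CappedBallLid

/-! ### §1 Maps into a regular level of a function on an open subset of `ℝ³` -/

section Level

variable {U : TopologicalSpace.Opens (EuclideanSpace ℝ (Fin 3))} {g : U → ℝ}
  (h : IsRegularLevel (𝓡 3) g 0)

/-- **The level read in `ℝ³`**, `ι = val ∘ incl : RegularLevel h → ℝ³`, **is a smooth embedding**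
(for a compact level): smooth, injective, with injective differential (the inclusion of the
level is an immersion, `RegularLevel.isSmoothEmbedding_incl`, and so is the inclusion of the open
set, `Manifold.IsSmoothEmbedding.of_opens`). [folklore] -/
theorem isSmoothEmbedding_val_comp_incl [CompactSpace (RegularLevel h)] :
    Manifold.IsSmoothEmbedding (𝓡 2) 𝓘(ℝ, EuclideanSpace ℝ (Fin 3)) ∞
      (Subtype.val ∘ RegularLevel.incl h) := by
  have hc : ContMDiff (𝓡 2) 𝓘(ℝ, EuclideanSpace ℝ (Fin 3)) ∞ (Subtype.val ∘ RegularLevel.incl h) :=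
    (contMDiff_subtype_val (n := ∞)).comp (RegularLevel.contMDiff_incl h)
  have hinj : Injective (Subtype.val ∘ RegularLevel.incl h) :=
    Subtype.val_injective.comp (RegularLevel.isSmoothEmbedding_incl h).isEmbedding.injective
  refine isSmoothEmbedding_of_injective_of_injective_mfderiv hc (by exact_mod_cast le_top) hinj
    fun z => ?_
  have h1 : MDifferentiableAt (𝓡 2) (𝓡 3) (RegularLevel.incl h) z :=
    (RegularLevel.contMDiff_incl h z).mdifferentiableAt (by simp)
  have h2 : MDifferentiableAt (𝓡 3) 𝓘(ℝ, EuclideanSpace ℝ (Fin 3))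
      (Subtype.val : U → EuclideanSpace ℝ (Fin 3)) (RegularLevel.incl h z) :=
    (contMDiff_subtype_val (n := ∞) _).mdifferentiableAt (by simp)
  rw [mfderiv_comp z h2 h1]
  exact (injective_mfderiv_of_isImmersionAt'
    ((Manifold.IsSmoothEmbedding.of_opens U).isImmersion.isImmersionAt _)).comp
    (injective_mfderiv_of_isImmersionAt'
      ((RegularLevel.isSmoothEmbedding_incl h).isImmersion.isImmersionAt z))

variable {EX HX : Type*} [NormedAddCommGroup EX] [NormedSpace ℝ EX] [TopologicalSpace HX]
  {K : ModelWithCorners ℝ EX HX} {X : Type*} [TopologicalSpace X] [ChartedSpace HX X]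

/-- **Smoothness into the level**: a map `φ` into the level is smooth as soon as it is smooth read
in `ℝ³`. [folklore] -/
theorem contMDiff_of_val_incl_comp {φ : X → RegularLevel h}
    (hφ : ContMDiff K 𝓘(ℝ, EuclideanSpace ℝ (Fin 3)) ∞ (Subtype.val ∘ RegularLevel.incl h ∘ φ)) :
    ContMDiff K (𝓡 2) ∞ φ := by
  have h1 : ContMDiff K (𝓡 3) ∞ (RegularLevel.incl h ∘ φ) :=
    (ContMDiff.subtypeVal_comp_iff U (RegularLevel.incl h ∘ φ)).1 hφ
  exact SchoenfliesTools.contMDiff_of_comp_isSmoothEmbedding (RegularLevel.isSmoothEmbedding_incl h) h1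

/-- **Injective differential into the level**: transferred from the map read in `ℝ³`.
[folklore] -/
theorem injective_mfderiv_of_val_incl_comp {φ : X → RegularLevel h}
    (hφ : ContMDiff K 𝓘(ℝ, EuclideanSpace ℝ (Fin 3)) ∞ (Subtype.val ∘ RegularLevel.incl h ∘ φ))
    {x : X} (hinj : Injective (mfderiv K 𝓘(ℝ, EuclideanSpace ℝ (Fin 3))
      (Subtype.val ∘ RegularLevel.incl h ∘ φ) x)) :
    Injective (mfderiv K (𝓡 2) φ x) := by
  have h1 : ContMDiff K (𝓡 3) ∞ (RegularLevel.incl h ∘ φ) :=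
    (ContMDiff.subtypeVal_comp_iff U (RegularLevel.incl h ∘ φ)).1 hφ
  have hd1 : MDifferentiableAt K (𝓡 3) (RegularLevel.incl h ∘ φ) x := (h1 x).mdifferentiableAt (by simp)
  have hd2 : MDifferentiableAt (𝓡 3) 𝓘(ℝ, EuclideanSpace ℝ (Fin 3))
      (Subtype.val : U → EuclideanSpace ℝ (Fin 3)) ((RegularLevel.incl h ∘ φ) x) :=
    (contMDiff_subtype_val (n := ∞) _).mdifferentiableAt (by simp)
  have e : mfderiv K 𝓘(ℝ, EuclideanSpace ℝ (Fin 3)) (Subtype.val ∘ RegularLevel.incl h ∘ φ) x =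
      (mfderiv (𝓡 3) 𝓘(ℝ, EuclideanSpace ℝ (Fin 3)) (Subtype.val : U → EuclideanSpace ℝ (Fin 3))
        ((RegularLevel.incl h ∘ φ) x)).comp (mfderiv K (𝓡 3) (RegularLevel.incl h ∘ φ) x) :=
    mfderiv_comp x hd2 hd1
  rw [e] at hinj
  exact SchoenfliesTools.injective_mfderiv_of_comp_isSmoothEmbedding
    (RegularLevel.isSmoothEmbedding_incl h) h1 (Injective.of_comp hinj)

end Level

/-! ### §2 The circle `β_c` parametrised -/

/-- **The circle `β_c = {a = 0, ρ² = 1 + s/2}` is a smoothly embedded round circle**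
`p ↦ (√(1+s/2) p₀, √(1+s/2) p₁, -s²/2)`. [folklore] -/
theorem exists_circleParam {s : ℝ} (hs : 0 < s) :
    ∃ γ : sphere (0 : EuclideanSpace ℝ (Fin 2)) 1 → EuclideanSpace ℝ (Fin 3),
      Manifold.IsSmoothEmbedding (𝓡 1) 𝓘(ℝ, EuclideanSpace ℝ (Fin 3)) ∞ γ ∧
      range γ = {x | topFun s x = 0 ∧ hsq x = 1 + s / 2} := by
  set c : ℝ := Real.sqrt (1 + s / 2) with hc
  have hc0 : 0 < c := Real.sqrt_pos.2 (by linarith)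
  have hc2 : c ^ 2 = 1 + s / 2 := Real.sq_sqrt (by linarith)
  -- the linear part `J w = (c w₀, c w₁, 0)`
  set J : EuclideanSpace ℝ (Fin 2) →L[ℝ] EuclideanSpace ℝ (Fin 3) :=
    (c • (EuclideanSpace.proj (𝕜 := ℝ) (0 : Fin 2) : EuclideanSpace ℝ (Fin 2) →L[ℝ] ℝ)).smulRight
        (EuclideanSpace.single (0 : Fin 3) (1 : ℝ)) +
      (c • (EuclideanSpace.proj (𝕜 := ℝ) (1 : Fin 2) : EuclideanSpace ℝ (Fin 2) →L[ℝ] ℝ)).smulRight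
        (EuclideanSpace.single (1 : Fin 3) (1 : ℝ)) with hJ
  have hJ0 : ∀ w, J w 0 = c * w 0 := fun w => by simp [hJ]
  have hJ1 : ∀ w, J w 1 = c * w 1 := fun w => by simp [hJ]
  have hJ2 : ∀ w, J w 2 = 0 := fun w => by simp [hJ]
  have hJinj : Injective J := by
    intro w w' hww'
    have e0 := congrArg (fun v : EuclideanSpace ℝ (Fin 3) => v 0) hww'
    have e1 := congrArg (fun v : EuclideanSpace ℝ (Fin 3) => v 1) hww'
    simp only [hJ0, hJ1] at e0 e1
    ext i
    fin_cases i
    · exact mul_left_cancel₀ hc0.ne' e0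
    · exact mul_left_cancel₀ hc0.ne' e1
  set q : EuclideanSpace ℝ (Fin 3) := (-(s ^ 2 / 2)) • EuclideanSpace.single (2 : Fin 3) (1 : ℝ) with hq
  set γ : sphere (0 : EuclideanSpace ℝ (Fin 2)) 1 → EuclideanSpace ℝ (Fin 3) :=
    fun p => J (p : EuclideanSpace ℝ (Fin 2)) + q with hγ
  have hγ0 : ∀ p, γ p 0 = c * (p : EuclideanSpace ℝ (Fin 2)) 0 := fun p => by simp [hγ, hq, hJ0]
  have hγ1 : ∀ p, γ p 1 = c * (p : EuclideanSpace ℝ (Fin 2)) 1 := fun p => by simp [hγ, hq, hJ1]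
  have hγ2 : ∀ p, γ p 2 = -(s ^ 2 / 2) := fun p => by simp [hγ, hq, hJ2]
  have hnorm : ∀ p : sphere (0 : EuclideanSpace ℝ (Fin 2)) 1,
      (p : EuclideanSpace ℝ (Fin 2)) 0 ^ 2 + (p : EuclideanSpace ℝ (Fin 2)) 1 ^ 2 = 1 := by
    intro p
    have h1 : ‖(p : EuclideanSpace ℝ (Fin 2))‖ = 1 := by simp
    have h2 := EuclideanSpace.norm_sq_eq (p : EuclideanSpace ℝ (Fin 2))
    rw [h1, Fin.sum_univ_two] at h2
    simp only [one_pow, Real.norm_eq_abs, sq_abs] at h2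
    linarith
  have hhsq : ∀ p, hsq (γ p) = 1 + s / 2 := by
    intro p
    simp only [hsq, hγ0, hγ1]
    nlinarith [hnorm p, hc2]
  have htop : ∀ p, topFun s (γ p) = 0 := by
    intro p
    unfold topFun
    rw [hhsq, hγ2]
    ring
  -- smoothness, injectivity, injective differential
  haveI : Fact (Module.finrank ℝ (EuclideanSpace ℝ (Fin 2)) = 1 + 1) := ⟨by simp⟩
  have hcoe : ContMDiff (𝓡 1) 𝓘(ℝ, EuclideanSpace ℝ (Fin 2)) ∞
      (fun p : sphere (0 : EuclideanSpace ℝ (Fin 2)) 1 => (p : EuclideanSpace ℝ (Fin 2))) :=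
    contMDiff_coe_sphere
  have hγs : ContMDiff (𝓡 1) 𝓘(ℝ, EuclideanSpace ℝ (Fin 3)) ∞ γ :=
    (J.contDiff.contMDiff.comp hcoe).add contMDiff_const
  have hγinj : Injective γ := by
    intro p p' hpp'
    have : J (p : EuclideanSpace ℝ (Fin 2)) = J p' := by
      have := congrArg (fun v => v - q) hpp'
      simpa [hγ] using this
    exact Subtype.ext (hJinj this)
  have hγd : ∀ p, Injective (mfderiv (𝓡 1) 𝓘(ℝ, EuclideanSpace ℝ (Fin 3)) γ p) := by
    intro p
    have hdcoe : MDifferentiableAt (𝓡 1) 𝓘(ℝ, EuclideanSpace ℝ (Fin 2))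
        (fun p : sphere (0 : EuclideanSpace ℝ (Fin 2)) 1 => (p : EuclideanSpace ℝ (Fin 2))) p :=
      (hcoe p).mdifferentiableAt (by simp)
    have hJd : HasMFDerivAt 𝓘(ℝ, EuclideanSpace ℝ (Fin 2)) 𝓘(ℝ, EuclideanSpace ℝ (Fin 3))
        (fun w => J w + q) (p : EuclideanSpace ℝ (Fin 2)) J := by
      have := (J.hasFDerivAt.add_const q).hasMFDerivAt (x := (p : EuclideanSpace ℝ (Fin 2)))
      exact this
    have hcomp : HasMFDerivAt (𝓡 1) 𝓘(ℝ, EuclideanSpace ℝ (Fin 3)) γ p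
        (J.comp (mfderiv (𝓡 1) 𝓘(ℝ, EuclideanSpace ℝ (Fin 2))
          (fun p : sphere (0 : EuclideanSpace ℝ (Fin 2)) 1 => (p : EuclideanSpace ℝ (Fin 2))) p)) :=
      hJd.comp p hdcoe.hasMFDerivAt
    rw [hcomp.mfderiv]
    exact hJinj.comp (mfderiv_coe_sphere_injective (n := 1) p)
  refine ⟨γ, isSmoothEmbedding_of_injective_of_injective_mfderiv hγs (by exact_mod_cast le_top)
    hγinj hγd, ?_⟩
  -- the range
  ext x
  simp only [mem_range, mem_setOf_eq]
  constructor
  · rintro ⟨p, rfl⟩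
    exact ⟨htop p, hhsq p⟩
  · rintro ⟨ha, hh⟩
    have hx2 : x 2 = -(s ^ 2 / 2) := by
      have := coord_two_eq_of_topFun_eq_zero ha
      rw [hh] at this
      linarith
    -- the preimage point on the circle
    set w : EuclideanSpace ℝ (Fin 2) := !₂[x 0 / c, x 1 / c] with hw
    have hw0 : w 0 = x 0 / c := by simp [hw]
    have hw1 : w 1 = x 1 / c := by simp [hw]
    have hwn : ‖w‖ = 1 := by
      have h2 := EuclideanSpace.norm_sq_eq w
      rw [Fin.sum_univ_two] at h2
      simp only [Real.norm_eq_abs, sq_abs, hw0, hw1, div_pow] at h2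
      have hx : x 0 ^ 2 + x 1 ^ 2 = 1 + s / 2 := hh
      have : ‖w‖ ^ 2 = 1 := by
        rw [h2, hc2, ← add_div, hx, div_self (by linarith)]
      nlinarith [norm_nonneg w]
    refine ⟨⟨w, by simp [hwn]⟩, ?_⟩
    ext i
    fin_cases i
    · show γ ⟨w, _⟩ 0 = x 0
      rw [hγ0]; simp only [hw0]; field_simp
    · show γ ⟨w, _⟩ 1 = x 1
      rw [hγ1]; simp only [hw1]; field_simp
    · show γ ⟨w, _⟩ 2 = x 2
      rw [hγ2, hx2]

/-! ### §3 Squashing the plane onto a disc; the dome disc in the level -/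

/-- **A smooth radial squash of the plane into the disc `{|w|² ≤ A₀}` which is the identity on
`{|w|² ≤ A₀ - κ'}`**: `w ↦ √(A₀ / (A₀ ⊔_κ' |w|²)) w`. [folklore] -/
theorem exists_squash {P : ℝ → ℝ} (hP : Admissible P) {A₀ κ' : ℝ} (hκ : 0 < κ') (hκA : κ' < A₀) :
    ∃ sq : EuclideanSpace ℝ (Fin 2) → EuclideanSpace ℝ (Fin 2), ContDiff ℝ ∞ sq ∧
      (∀ w, w 0 ^ 2 + w 1 ^ 2 ≤ A₀ - κ' → sq w = w) ∧
      (∀ w, (sq w) 0 ^ 2 + (sq w) 1 ^ 2 ≤ A₀) ∧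
      (∀ w, ∃ t : ℝ, 0 < t ∧ sq w = t • w) := by
  have hA : 0 < A₀ := by linarith
  set nrm : EuclideanSpace ℝ (Fin 2) → ℝ := fun w => w 0 ^ 2 + w 1 ^ 2 with hnrm
  have hnrm_s : ContDiff ℝ ∞ nrm := by
    have h0 : ContDiff ℝ ∞ fun w : EuclideanSpace ℝ (Fin 2) => w 0 := contDiff_piLp_apply (p := 2) (i := (0 : Fin 2))
    have h1 : ContDiff ℝ ∞ fun w : EuclideanSpace ℝ (Fin 2) => w 1 := contDiff_piLp_apply (p := 2) (i := (1 : Fin 2))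
    exact (h0.pow 2).add (h1.pow 2)
  set m : EuclideanSpace ℝ (Fin 2) → ℝ := fun w => A₀ + κ' * P ((nrm w - A₀) / κ') with hm
  have hm_s : ContDiff ℝ ∞ m := SmoothMax.contDiff_smax hP.hP contDiff_const hnrm_s
  have hm_ge : ∀ w, max A₀ (nrm w) ≤ m w := fun w => SmoothMax.max_le_smax hP.hPge hκ _ _
  have hm_pos : ∀ w, 0 < m w := fun w => lt_of_lt_of_le hA ((le_max_left _ _).trans (hm_ge w))
  set lam : EuclideanSpace ℝ (Fin 2) → ℝ := fun w => Real.sqrt (A₀ / m w) with hlam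
  have hlam_s : ContDiff ℝ ∞ lam := by
    refine ContDiff.sqrt (contDiff_const.div hm_s fun w => (hm_pos w).ne') fun w => ?_
    exact (div_pos hA (hm_pos w)).ne'
  have hlam_pos : ∀ w, 0 < lam w := fun w => Real.sqrt_pos.2 (div_pos hA (hm_pos w))
  have hlam_sq : ∀ w, lam w ^ 2 = A₀ / m w := fun w => Real.sq_sqrt (div_pos hA (hm_pos w)).le
  refine ⟨fun w => lam w • w, hlam_s.smul contDiff_id, fun w hw => ?_, fun w => ?_, fun w => ⟨lam w, hlam_pos w, rfl⟩⟩
  · have hmw : m w = A₀ := SmoothMax.smax_eq_left hP.hP0 hκ (by simp only [hnrm]; linarith)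
    have : lam w = 1 := by simp only [hlam, hmw, div_self hA.ne', Real.sqrt_one]
    show lam w • w = w
    rw [this, one_smul]
  · simp only [PiLp.smul_apply, smul_eq_mul, mul_pow]
    have hn : nrm w ≤ m w := (le_max_right _ _).trans (hm_ge w)
    have h0 : 0 ≤ nrm w := by simp only [hnrm]; positivity
    calc lam w ^ 2 * w 0 ^ 2 + lam w ^ 2 * w 1 ^ 2 = (A₀ / m w) * nrm w := by rw [hlam_sq]; simp only [hnrm]; ring
      _ ≤ (A₀ / m w) * m w := mul_le_mul_of_nonneg_left hn (div_pos hA (hm_pos w)).le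
      _ = A₀ := div_mul_cancel₀ _ (hm_pos w).ne'

section Dome

variable {F : EuclideanSpace ℝ (Fin 3) → ℝ} {P : ℝ → ℝ} {E₁ E₂ : Set (EuclideanSpace ℝ (Fin 3))}
  {w₀ η₀ ε₀ s δ : ℝ}

/-- Points of the dome/annulus graph `{a = 0, ρ² ≤ (1+s/2)²}` are in the sub-sphere. [folklore] -/
theorem mem_subSphere_of_topFun_eq_zero (hP : Admissible P) (hN : StepNF F E₁ E₂ w₀ η₀ ε₀)
    (hS : StepScale s δ w₀ η₀) {x : EuclideanSpace ℝ (Fin 3)} (ha : topFun s x = 0)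
    (h1 : hsq x ≤ (1 + s / 2) ^ 2) : x ∈ subSphere F P E₁ s δ ε₀ := by
  obtain ⟨hs, hs1, -, -, -, -⟩ := scales hS
  have hG : lidFun P s x = 0 := lidFun_eq_zero_of_topFun_eq_zero hP.hP0 hs (by linarith) ha h1
  have hz : x 2 = s * (1 - hsq x) := coord_two_eq_of_topFun_eq_zero ha
  have hmul := mul_le_mul_of_nonneg_left h1 hs.le
  have h3 : s * (1 + s / 2) ^ 2 ≤ 3 * s := by
    have : (1 + s / 2) ^ 2 ≤ 3 := by nlinarith
    nlinarith [mul_le_mul_of_nonneg_left this hs.le]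
  rw [subSphere_eq hP hN hS]
  exact Or.inl (Or.inl ⟨hG, by rw [hz]; nlinarith⟩)

/-- **The dome disc embedded in the level surface.**  There is a smooth embedding
`jB : 𝔻² → RegularLevel h` of the closed disc whose image read in `ℝ³` is the dome disc
`{a = 0, ρ² ≤ 1 + s/2}`, namely (on `𝔻²`) `a ↦ (√(1+s/2) a₀, √(1+s/2) a₁, s(1 - (1+s/2)|a|²))`.
[folklore] -/
theorem exists_domeDiscEmb (hP : Admissible P) (hN : StepNF F E₁ E₂ w₀ η₀ ε₀) (hS : StepScale s δ w₀ η₀) :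
    ∃ jB : closedBall (0 : EuclideanSpace ℝ (Fin 2)) 1 → RegularLevel (isRegularLevel_subFun hP hN hS),
      Manifold.IsSmoothEmbedding (𝓡∂ 2) (𝓡 2) ∞ jB ∧
      (∀ a, topFun s (Subtype.val (RegularLevel.incl (isRegularLevel_subFun hP hN hS) (jB a))) = 0 ∧
        hsq (Subtype.val (RegularLevel.incl (isRegularLevel_subFun hP hN hS) (jB a))) =
          (1 + s / 2) * ((a : EuclideanSpace ℝ (Fin 2)) 0 ^ 2 + (a : EuclideanSpace ℝ (Fin 2)) 1 ^ 2)) ∧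
      (∀ x, topFun s x = 0 → hsq x ≤ 1 + s / 2 →
        ∃ a, Subtype.val (RegularLevel.incl (isRegularLevel_subFun hP hN hS) (jB a)) = x) := by
  obtain ⟨hs, hs1, hsw, hsη, hδ, hδs⟩ := scales hS
  set h := isRegularLevel_subFun hP hN hS with hh
  haveI : CompactSpace (RegularLevel h) := by
    rw [← isCompact_univ_iff, (RegularLevel.isEmbedding_incl h).isCompact_iff, image_univ,
      RegularLevel.range_incl, Topology.IsEmbedding.subtypeVal.isCompact_iff, image_val_preimage_eq hN]
    exact isCompact_subSphere hP hN hS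
  set c : ℝ := Real.sqrt (1 + s / 2) with hc
  have hc0 : 0 < c := Real.sqrt_pos.2 (by linarith)
  have hc2 : c ^ 2 = 1 + s / 2 := Real.sq_sqrt (by linarith)
  -- the explicit map `jB₀ w = J w + g(w) e₂`
  set J : EuclideanSpace ℝ (Fin 2) →L[ℝ] EuclideanSpace ℝ (Fin 3) :=
    (c • (EuclideanSpace.proj (𝕜 := ℝ) (0 : Fin 2) : EuclideanSpace ℝ (Fin 2) →L[ℝ] ℝ)).smulRight
        (EuclideanSpace.single (0 : Fin 3) (1 : ℝ)) +
      (c • (EuclideanSpace.proj (𝕜 := ℝ) (1 : Fin 2) : EuclideanSpace ℝ (Fin 2) →L[ℝ] ℝ)).smulRight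
        (EuclideanSpace.single (1 : Fin 3) (1 : ℝ)) with hJ
  have hJ0 : ∀ w, J w 0 = c * w 0 := fun w => by simp [hJ]
  have hJ1 : ∀ w, J w 1 = c * w 1 := fun w => by simp [hJ]
  have hJ2 : ∀ w, J w 2 = 0 := fun w => by simp [hJ]
  set g : EuclideanSpace ℝ (Fin 2) → ℝ := fun w => s * (1 - (1 + s / 2) * (w 0 ^ 2 + w 1 ^ 2)) with hg
  have hg_s : ContDiff ℝ ∞ g := by
    have h0 : ContDiff ℝ ∞ fun w : EuclideanSpace ℝ (Fin 2) => w 0 := contDiff_piLp_apply (p := 2) (i := (0 : Fin 2))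
    have h1 : ContDiff ℝ ∞ fun w : EuclideanSpace ℝ (Fin 2) => w 1 := contDiff_piLp_apply (p := 2) (i := (1 : Fin 2))
    exact contDiff_const.mul (contDiff_const.sub (contDiff_const.mul ((h0.pow 2).add (h1.pow 2))))
  set e₂ : EuclideanSpace ℝ (Fin 3) := EuclideanSpace.single (2 : Fin 3) (1 : ℝ) with he₂
  set jB₀ : EuclideanSpace ℝ (Fin 2) → EuclideanSpace ℝ (Fin 3) := fun w => J w + g w • e₂ with hjB₀
  have hj0 : ∀ w, jB₀ w 0 = c * w 0 := fun w => by simp [hjB₀, he₂, hJ0]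
  have hj1 : ∀ w, jB₀ w 1 = c * w 1 := fun w => by simp [hjB₀, he₂, hJ1]
  have hj2 : ∀ w, jB₀ w 2 = s * (1 - (1 + s / 2) * (w 0 ^ 2 + w 1 ^ 2)) := fun w => by
    simp [hjB₀, he₂, hJ2, hg]
  have hjhsq : ∀ w, hsq (jB₀ w) = (1 + s / 2) * (w 0 ^ 2 + w 1 ^ 2) := fun w => by
    simp only [hsq, hj0, hj1]; nlinarith [hc2]
  have hjtop : ∀ w, topFun s (jB₀ w) = 0 := fun w => by
    unfold topFun; rw [hjhsq, hj2]; ring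
  have hj_s : ContDiff ℝ ∞ jB₀ := J.contDiff.add (hg_s.smul contDiff_const)
  have hj_inj : Injective jB₀ := by
    intro w w' hww'
    have e0 := congrArg (fun v : EuclideanSpace ℝ (Fin 3) => v 0) hww'
    have e1 := congrArg (fun v : EuclideanSpace ℝ (Fin 3) => v 1) hww'
    simp only [hj0, hj1] at e0 e1
    ext i; fin_cases i
    · exact mul_left_cancel₀ hc0.ne' e0
    · exact mul_left_cancel₀ hc0.ne' e1
  -- the derivative `J + Dg ⊗ e₂` is injective (its first two components are `c` times the identity)
  have hj_fd : ∀ w, HasFDerivAt jB₀ (J + (fderiv ℝ g w).smulRight e₂) w := fun w =>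
    J.hasFDerivAt.add (((hg_s.differentiable (by simp)) w).hasFDerivAt.smul_const e₂)
  have hj_d : ∀ w, Injective (fderiv ℝ jB₀ w) := by
    intro w u u' huu'
    rw [(hj_fd w).fderiv] at huu'
    have e0 := congrArg (fun v : EuclideanSpace ℝ (Fin 3) => v 0) huu'
    have e1 := congrArg (fun v : EuclideanSpace ℝ (Fin 3) => v 1) huu'
    simp only [add_apply, ContinuousLinearMap.smulRight_apply, PiLp.add_apply,
      PiLp.smul_apply, smul_eq_mul, hJ0, hJ1, he₂] at e0 e1
    simp at e0 e1
    ext i; fin_cases i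
    · exact e0.resolve_right hc0.ne'
    · exact e1.resolve_right hc0.ne'
  -- the squash and the map `m = jB₀ ∘ sq` into `W`
  obtain ⟨sq, hsq_s, hsq_id, hsq_le, -⟩ := exists_squash hP (A₀ := 1 + s / 4) (κ' := s / 16)
    (by linarith) (by linarith)
  set m : EuclideanSpace ℝ (Fin 2) → EuclideanSpace ℝ (Fin 3) := jB₀ ∘ sq with hm
  have hm_s : ContDiff ℝ ∞ m := hj_s.comp hsq_s
  have hm_mem : ∀ w, m w ∈ subSphere F P E₁ s δ ε₀ := by
    intro w
    refine mem_subSphere_of_topFun_eq_zero hP hN hS (hjtop _) ?_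
    show hsq (jB₀ (sq w)) ≤ _
    rw [hjhsq]
    nlinarith [hsq_le w]
  have hm_eq : ∀ w, w 0 ^ 2 + w 1 ^ 2 ≤ 1 + 3 * s / 16 → m w = jB₀ w := fun w hw => by
    simp only [hm, comp_apply, hsq_id w (by linarith)]
  -- the map into the level surface
  set φ : EuclideanSpace ℝ (Fin 2) → RegularLevel h := fun w => ⟨⟨m w, (hm_mem w).1⟩, (hm_mem w).2⟩ with hφ
  have hιφ : Subtype.val ∘ RegularLevel.incl h ∘ φ = m := rfl
  have hφ_s : ContMDiff 𝓘(ℝ, EuclideanSpace ℝ (Fin 2)) (𝓡 2) ∞ φ :=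
    contMDiff_of_val_incl_comp h (by rw [hιφ]; exact hm_s.contMDiff)
  -- near the closed disc, `m = jB₀`
  have hm_ev : ∀ w, w 0 ^ 2 + w 1 ^ 2 ≤ 1 → m =ᶠ[𝓝 w] jB₀ := by
    intro w hw
    have hopen : IsOpen {y : EuclideanSpace ℝ (Fin 2) | y 0 ^ 2 + y 1 ^ 2 < 1 + 3 * s / 16} := by
      have h0 : Continuous fun y : EuclideanSpace ℝ (Fin 2) => y 0 := (EuclideanSpace.proj (𝕜 := ℝ) (0 : Fin 2)).continuous
      have h1 : Continuous fun y : EuclideanSpace ℝ (Fin 2) => y 1 := (EuclideanSpace.proj (𝕜 := ℝ) (1 : Fin 2)).continuous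
      exact isOpen_lt ((h0.pow 2).add (h1.pow 2)) continuous_const
    filter_upwards [hopen.mem_nhds (show w 0 ^ 2 + w 1 ^ 2 < 1 + 3 * s / 16 by linarith)] with y hy
    exact hm_eq y (le_of_lt hy)
  have hball : ∀ a : EuclideanSpace ℝ (Fin 2), a ∈ closedBall (0 : EuclideanSpace ℝ (Fin 2)) 1 →
      a 0 ^ 2 + a 1 ^ 2 ≤ 1 := by
    intro a ha
    rw [mem_closedBall, dist_zero_right] at ha
    rw [← norm_sq_eq_add_sq]
    nlinarith [norm_nonneg a]
  have hφ_inj : InjOn φ (closedBall (0 : EuclideanSpace ℝ (Fin 2)) 1) := by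
    intro a ha b hb hab
    have : m a = m b := congrArg (fun z => Subtype.val (RegularLevel.incl h z)) hab
    rw [hm_eq a (by linarith [hball a ha]), hm_eq b (by linarith [hball b hb])] at this
    exact hj_inj this
  have hφ_d : ∀ a ∈ closedBall (0 : EuclideanSpace ℝ (Fin 2)) 1,
      Injective (mfderiv 𝓘(ℝ, EuclideanSpace ℝ (Fin 2)) (𝓡 2) φ a) := by
    intro a ha
    refine injective_mfderiv_of_val_incl_comp h (by rw [hιφ]; exact hm_s.contMDiff) ?_
    rw [hιφ, mfderiv_eq_fderiv, (hm_ev a (hball a ha)).fderiv_eq]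
    exact hj_d a
  set jB : closedBall (0 : EuclideanSpace ℝ (Fin 2)) 1 → RegularLevel h := φ ∘ Subtype.val with hjB
  have hjB_emb : Manifold.IsSmoothEmbedding (𝓡∂ 2) (𝓡 2) ∞ jB :=
    isSmoothEmbedding_comp_coe_closedBall_of_injective_mfderiv (n := 1) (m := 2) hφ_s hφ_inj hφ_d
  have hjB_val : ∀ a : closedBall (0 : EuclideanSpace ℝ (Fin 2)) 1,
      Subtype.val (RegularLevel.incl h (jB a)) = jB₀ a := fun a =>
    hm_eq a (by linarith [hball a a.2])
  refine ⟨jB, hjB_emb, fun a => ?_, fun x hx1 hx2 => ?_⟩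
  · rw [hjB_val]; exact ⟨hjtop _, hjhsq _⟩
  · -- surjectivity onto the dome disc
    set w : EuclideanSpace ℝ (Fin 2) := !₂[x 0 / c, x 1 / c] with hw
    have hw0 : w 0 = x 0 / c := by simp [hw]
    have hw1 : w 1 = x 1 / c := by simp [hw]
    have hwn : w 0 ^ 2 + w 1 ^ 2 = hsq x / (1 + s / 2) := by
      rw [hw0, hw1, div_pow, div_pow, hc2, ← add_div]; rfl
    have hwball : w ∈ closedBall (0 : EuclideanSpace ℝ (Fin 2)) 1 := by
      rw [mem_closedBall, dist_zero_right]
      have h1 : w 0 ^ 2 + w 1 ^ 2 ≤ 1 := by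
        rw [hwn, div_le_one (by linarith)]; exact hx2
      have : ‖w‖ ^ 2 ≤ 1 := by rw [norm_sq_eq_add_sq]; exact h1
      nlinarith [norm_nonneg w]
    refine ⟨⟨w, hwball⟩, ?_⟩
    rw [hjB_val]
    have hz := coord_two_eq_of_topFun_eq_zero hx1
    ext i; fin_cases i
    · show jB₀ w 0 = x 0
      rw [hj0, hw0]; field_simp
    · show jB₀ w 1 = x 1
      rw [hj1, hw1]; field_simp
    · show jB₀ w 2 = x 2
      rw [hj2, hwn, hz]; field_simp

end Dome

/-! ### §4 The lower wall point; the sub-sphere parametrised by the round sphere -/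

variable {F : EuclideanSpace ℝ (Fin 3) → ℝ} {P : ℝ → ℝ} {E₁ E₂ : Set (EuclideanSpace ℝ (Fin 3))}
  {w₀ η₀ ε₀ s δ : ℝ}

/-- **The lower wall point `(1, 0, -6s)`**: a zero of the filled function, in the sub-sphere
(its low piece), off `V` and off the circle `β_c`. [folklore] -/
theorem lowerWallPoint (hP : Admissible P) (hN : StepNF F E₁ E₂ w₀ η₀ ε₀) (hS : StepScale s δ w₀ η₀) :
    let q := EuclideanSpace.single (0 : Fin 3) (1 : ℝ) + (-6 * s) • EuclideanSpace.single (2 : Fin 3) (1 : ℝ)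
    fillFun F P s δ ((1 + s) ^ 2 + ε₀ + 2) q = 0 ∧ q ∈ subSphere F P E₁ s δ ε₀ ∧
      ¬ (hsq q < 1 + s / 2 ∧ -s ^ 2 < q 2 ∧ q 2 < 2 * s) ∧ ¬ (topFun s q = 0 ∧ hsq q = 1 + s / 2) := by
  intro q
  obtain ⟨hs, hs1, hsw, hsη, hδ, hδs⟩ := scales hS
  have hq0 : q 0 = 1 := by simp [q]
  have hq1 : q 1 = 0 := by simp [q]
  have hq2 : q 2 = -6 * s := by simp [q]
  have hh : hsq q = 1 := by simp [hsq, hq0, hq1]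
  have hqB : q ∈ closedBox s := ⟨by rw [hh]; nlinarith, by rw [hq2], by rw [hq2]; linarith⟩
  have hF : F q = 0 := by
    rw [F_eq_of_box hN hS (by rw [hh]; nlinarith) (by rw [hq2, abs_of_neg (by linarith)]; linarith), hh]; ring
  have hG : lidFun P s q = hsq q - 1 :=
    lidFun_eq_hsq_sub_one hP.hP1 hs (by linarith) (by rw [hq2]; linarith) (by rw [hh]; simp; linarith)
  have hw1 : F q ≤ fillWeight P s δ ((1 + s) ^ 2 + ε₀ + 2) q - 1 - δ := by
    have hε₀ := hN.hε₀
    unfold fillWeight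
    rw [collarCutoff_eq_zero hs (by rw [hq2]; linarith)]
    have hψ := (pushCutoff_mem_Icc hs q).1
    have hM : (0:ℝ) ≤ (1 + s) ^ 2 + ε₀ + 2 := by positivity
    rw [hF, hG, hh]
    nlinarith [mul_nonneg hM hψ]
  have hF2 : fillFun F P s δ ((1 + s) ^ 2 + ε₀ + 2) q = 0 := by
    rw [fillFun_eq_left hP.hP0 hδ hw1]; exact hF
  refine ⟨hF2, ?_, fun h => by rw [hq2] at h; nlinarith [h.2.1], fun h => by rw [hh] at h; linarith [h.2]⟩
  rw [subSphere_eq hP hN hS]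
  exact Or.inl (Or.inr ⟨hF2, by rw [hq2]; linarith, hqB⟩)

/-- From `‖a‖ ≤ 1`: `a₀² + a₁² ≤ 1`. [folklore] -/
theorem sq_add_sq_le_one_of_mem {a : EuclideanSpace ℝ (Fin 2)}
    (ha : a ∈ closedBall (0 : EuclideanSpace ℝ (Fin 2)) 1) : a 0 ^ 2 + a 1 ^ 2 ≤ 1 := by
  rw [mem_closedBall, dist_zero_right] at ha
  rw [← norm_sq_eq_add_sq]
  exact pow_le_one₀ (norm_nonneg a) ha

/-- From `a₀² + a₁² = 1`: `‖a‖ = 1`. [folklore] -/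
theorem norm_eq_one_of_sq_add_sq {a : EuclideanSpace ℝ (Fin 2)} (ha : a 0 ^ 2 + a 1 ^ 2 = 1) : ‖a‖ = 1 := by
  have h := norm_sq_eq_add_sq a
  rw [ha] at h
  exact (pow_eq_one_iff_of_nonneg (norm_nonneg a) two_ne_zero).1 h

/-- **A disc of the sphere `𝕊²` whose image lies in `D_A` lifts to a smoothly embedded disc of
the level surface.**  If `f : 𝕊² → ℝ³` is a smooth embedding onto `{F₂ = 0}` and `e₁ : ℝ² → 𝕊²`
a smooth embedding with `f(e₁(𝔻²)) ⊆ D_A = W ∖ V`, then `f ∘ e₁` maps a neighbourhood of `𝔻²`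
into `W` (near `D_A` the surfaces `{F₂ = 0}` and `W` agree), so — after a radial squash of the
plane onto that neighbourhood — it lifts to a smooth map into the level surface, a smooth
embedding on `𝔻²`. [folklore] -/
theorem exists_levelDiscEmb (hP : Admissible P) (hN : StepNF F E₁ E₂ w₀ η₀ ε₀) (hS : StepScale s δ w₀ η₀)
    {f : sphere (0 : EuclideanSpace ℝ (Fin 3)) 1 → EuclideanSpace ℝ (Fin 3)}
    (hf : Manifold.IsSmoothEmbedding (𝓡 2) 𝓘(ℝ, EuclideanSpace ℝ (Fin 3)) ∞ f)
    (hZ₁ : ∀ y, fillFun F P s δ ((1 + s) ^ 2 + ε₀ + 2) (f y) = 0)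
    {e₁ : EuclideanSpace ℝ (Fin 2) → sphere (0 : EuclideanSpace ℝ (Fin 3)) 1}
    (he₁ : Manifold.IsSmoothEmbedding 𝓘(ℝ, EuclideanSpace ℝ (Fin 2)) (𝓡 2) ∞ e₁)
    (himg : ∀ w ∈ closedBall (0 : EuclideanSpace ℝ (Fin 2)) 1,
      f (e₁ w) ∈ subSphere F P E₁ s δ ε₀ ∧
        ¬ (hsq (f (e₁ w)) < 1 + s / 2 ∧ -s ^ 2 < f (e₁ w) 2 ∧ f (e₁ w) 2 < 2 * s)) :
    ∃ jA : closedBall (0 : EuclideanSpace ℝ (Fin 2)) 1 → RegularLevel (isRegularLevel_subFun hP hN hS),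
      Manifold.IsSmoothEmbedding (𝓡∂ 2) (𝓡 2) ∞ jA ∧
      ∀ a, Subtype.val (RegularLevel.incl (isRegularLevel_subFun hP hN hS) (jA a)) = f (e₁ a) := by
  set h := isRegularLevel_subFun hP hN hS with hh
  have hfinj : Injective f := hf.isEmbedding.injective
  have hfc : Continuous f := hf.contMDiff.continuous
  have he₁c : Continuous e₁ := he₁.contMDiff.continuous
  have he₁inj : Injective e₁ := he₁.isEmbedding.injective
  -- a neighbourhood of the closed disc mapping into `W`
  have hnb : ∀ w, w ∈ closedBall (0 : EuclideanSpace ℝ (Fin 2)) 1 →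
      ∃ O : Set (EuclideanSpace ℝ (Fin 2)), IsOpen O ∧ w ∈ O ∧
        ∀ w' ∈ O, f (e₁ w') ∈ subSphere F P E₁ s δ ε₀ := by
    intro w hw
    obtain ⟨hp1, hp2⟩ := himg w hw
    obtain ⟨N₁, hN₁, hN₁W⟩ := exists_mem_nhds_fillFun_zero_subset hP hN hS hp1 hp2
    have hpre : (f ∘ e₁) ⁻¹' N₁ ∈ 𝓝 w := (hfc.comp he₁c).continuousAt.preimage_mem_nhds hN₁
    obtain ⟨O, hO, hOo, hwO⟩ := _root_.mem_nhds_iff.1 hpre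
    exact ⟨O, hOo, hwO, fun w' hw' => hN₁W _ (hO hw') (hZ₁ _)⟩
  choose! O hOo hwO hOW using hnb
  set Ou : Set (EuclideanSpace ℝ (Fin 2)) := ⋃ w ∈ closedBall (0 : EuclideanSpace ℝ (Fin 2)) 1, O w with hOu
  have hOuo : IsOpen Ou := isOpen_biUnion fun w hw => hOo w hw
  have hsubOu : closedBall (0 : EuclideanSpace ℝ (Fin 2)) 1 ⊆ Ou := fun w hw =>
    mem_iUnion₂.2 ⟨w, hw, hwO w hw⟩
  have hOuW : ∀ w ∈ Ou, f (e₁ w) ∈ subSphere F P E₁ s δ ε₀ := by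
    intro w hw
    obtain ⟨w₁, hw₁, hww₁⟩ := mem_iUnion₂.1 hw
    exact hOW w₁ hw₁ w hww₁
  obtain ⟨ε, hε, hεsub⟩ := (isCompact_closedBall (0 : EuclideanSpace ℝ (Fin 2)) 1).exists_cthickening_subset_open
    hOuo hsubOu
  rw [cthickening_closedBall hε.le zero_le_one] at hεsub
  have hε0 : 0 < min ε 1 := lt_min hε one_pos
  obtain ⟨sq, hsq_s, hsq_id, hsq_le, -⟩ := exists_squash hP (A₀ := 1 + min ε 1) (κ' := min ε 1 / 2)
    (by linarith) (by linarith)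
  have hsq_mem : ∀ w, sq w ∈ Ou := by
    intro w
    apply hεsub
    rw [mem_closedBall, dist_zero_right]
    have h1 : ‖sq w‖ ^ 2 ≤ (1 + ε) ^ 2 := by
      rw [norm_sq_eq_add_sq]
      nlinarith [hsq_le w, min_le_left ε 1]
    nlinarith [norm_nonneg (sq w), h1, hε]
  -- the map `mA = f ∘ e₁ ∘ sq` into `W` and its lift `φA`
  set mA : EuclideanSpace ℝ (Fin 2) → EuclideanSpace ℝ (Fin 3) := f ∘ e₁ ∘ sq with hmA
  have hfe_s : ContMDiff 𝓘(ℝ, EuclideanSpace ℝ (Fin 2)) 𝓘(ℝ, EuclideanSpace ℝ (Fin 3)) ∞ (f ∘ e₁) :=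
    hf.contMDiff.comp he₁.contMDiff
  have hmA_s : ContMDiff 𝓘(ℝ, EuclideanSpace ℝ (Fin 2)) 𝓘(ℝ, EuclideanSpace ℝ (Fin 3)) ∞ mA :=
    hfe_s.comp hsq_s.contMDiff
  have hmA_mem : ∀ w, mA w ∈ subSphere F P E₁ s δ ε₀ := fun w => hOuW _ (hsq_mem w)
  set φA : EuclideanSpace ℝ (Fin 2) → RegularLevel h := fun w => ⟨⟨mA w, (hmA_mem w).1⟩, (hmA_mem w).2⟩
    with hφA
  have hιφA : Subtype.val ∘ RegularLevel.incl h ∘ φA = mA := rfl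
  have hφA_s : ContMDiff 𝓘(ℝ, EuclideanSpace ℝ (Fin 2)) (𝓡 2) ∞ φA :=
    contMDiff_of_val_incl_comp h (by rw [hιφA]; exact hmA_s)
  have hmA_eq : ∀ a : EuclideanSpace ℝ (Fin 2), a 0 ^ 2 + a 1 ^ 2 ≤ 1 → mA a = f (e₁ a) := fun a ha => by
    simp only [hmA, comp_apply, hsq_id a (by linarith)]
  have hmA_ev : ∀ a : EuclideanSpace ℝ (Fin 2), a 0 ^ 2 + a 1 ^ 2 ≤ 1 → mA =ᶠ[𝓝 a] (f ∘ e₁) := by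
    intro a ha
    have h0 : Continuous fun y : EuclideanSpace ℝ (Fin 2) => y 0 := (EuclideanSpace.proj (𝕜 := ℝ) (0 : Fin 2)).continuous
    have h1 : Continuous fun y : EuclideanSpace ℝ (Fin 2) => y 1 := (EuclideanSpace.proj (𝕜 := ℝ) (1 : Fin 2)).continuous
    have hopen : IsOpen {y : EuclideanSpace ℝ (Fin 2) | y 0 ^ 2 + y 1 ^ 2 < 1 + min ε 1 / 2} :=
      isOpen_lt ((h0.pow 2).add (h1.pow 2)) continuous_const
    filter_upwards [hopen.mem_nhds (show a 0 ^ 2 + a 1 ^ 2 < 1 + min ε 1 / 2 by linarith)] with y hy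
    have hy' : y 0 ^ 2 + y 1 ^ 2 ≤ 1 + min ε 1 - min ε 1 / 2 := by
      have := le_of_lt (show y 0 ^ 2 + y 1 ^ 2 < 1 + min ε 1 / 2 from hy); linarith
    simp only [hmA, comp_apply, hsq_id y hy']
  have hφA_inj : InjOn φA (closedBall (0 : EuclideanSpace ℝ (Fin 2)) 1) := by
    intro a ha b hb hab
    have : mA a = mA b := congrArg (fun z => Subtype.val (RegularLevel.incl h z)) hab
    rw [hmA_eq a (sq_add_sq_le_one_of_mem ha), hmA_eq b (sq_add_sq_le_one_of_mem hb)] at this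
    exact he₁inj (hfinj this)
  have hφA_d : ∀ a ∈ closedBall (0 : EuclideanSpace ℝ (Fin 2)) 1,
      Injective (mfderiv 𝓘(ℝ, EuclideanSpace ℝ (Fin 2)) (𝓡 2) φA a) := by
    intro a ha
    refine injective_mfderiv_of_val_incl_comp h (by rw [hιφA]; exact hmA_s) ?_
    rw [hιφA, (hmA_ev a (sq_add_sq_le_one_of_mem ha)).mfderiv_eq]
    have h1 : MDifferentiableAt 𝓘(ℝ, EuclideanSpace ℝ (Fin 2)) (𝓡 2) e₁ a :=
      (he₁.contMDiff a).mdifferentiableAt (by simp)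
    have h2 : MDifferentiableAt (𝓡 2) 𝓘(ℝ, EuclideanSpace ℝ (Fin 3)) f (e₁ a) :=
      (hf.contMDiff _).mdifferentiableAt (by simp)
    rw [mfderiv_comp a h2 h1]
    exact (injective_mfderiv_of_isImmersionAt' (hf.isImmersion.isImmersionAt _)).comp
      (injective_mfderiv_of_isImmersionAt' (he₁.isImmersion.isImmersionAt a))
  refine ⟨φA ∘ Subtype.val,
    isSmoothEmbedding_comp_coe_closedBall_of_injective_mfderiv (n := 1) (m := 2) hφA_s hφA_inj hφA_d,
    fun a => hmA_eq a (sq_add_sq_le_one_of_mem a.2)⟩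

/-- **The disc `D_A` is a disc of the sphere `{F₂ = 0}`.**  With `f : 𝕊² → ℝ³` a smooth
embedding onto `{F₂ = 0}`, the circle `f⁻¹(β_c)` cuts `𝕊²` into two discs `e₁(𝔻²)`, `e₂(𝔻²)`
(`SphereCircleSplitting.exists_two_discs`, `e₁(𝔹²)` containing the preimage of the lower wall
point); then `f(e₁(𝔻²)) = D_A`.  Connectedness argument: `{f ∈ D_A ∖ β_c}` is open (near `D_A`
the surfaces `{F₂ = 0}` and `W` agree) and closed in `𝕊² ∖ f⁻¹(β_c)`, contains the preimage of
the lower wall point and misses that of the upper wall point. [folklore] -/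
theorem image_disc_eq (hP : Admissible P) (hN : StepNF F E₁ E₂ w₀ η₀ ε₀) (hS : StepScale s δ w₀ η₀)
    {f : sphere (0 : EuclideanSpace ℝ (Fin 3)) 1 → EuclideanSpace ℝ (Fin 3)}
    (hf : Manifold.IsSmoothEmbedding (𝓡 2) 𝓘(ℝ, EuclideanSpace ℝ (Fin 3)) ∞ f)
    {T : Set (EuclideanSpace ℝ (Fin 3))}
    (hZ₁ : ∀ y, fillFun F P s δ ((1 + s) ^ 2 + ε₀ + 2) (f y) = 0)
    (hZ₂ : ∀ x, fillFun F P s δ ((1 + s) ^ 2 + ε₀ + 2) x = 0 → x ∉ T → x ∈ range f)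
    (hTW : ∀ x ∈ subSphere F P E₁ s δ ε₀, x ∉ T)
    (hTu : EuclideanSpace.single (0 : Fin 3) (1 : ℝ) + s • EuclideanSpace.single (2 : Fin 3) (1 : ℝ) ∉ T)
    {γ' : sphere (0 : EuclideanSpace ℝ (Fin 2)) 1 → sphere (0 : EuclideanSpace ℝ (Fin 3)) 1}
    (hγ' : Manifold.IsSmoothEmbedding (𝓡 1) (𝓡 2) ∞ γ')
    (hfγ' : range (f ∘ γ') = {x | topFun s x = 0 ∧ hsq x = 1 + s / 2})
    {e₁ e₂ : EuclideanSpace ℝ (Fin 2) → sphere (0 : EuclideanSpace ℝ (Fin 3)) 1}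
    (he₁ : Manifold.IsSmoothEmbedding 𝓘(ℝ, EuclideanSpace ℝ (Fin 2)) (𝓡 2) ∞ e₁)
    (he₂ : Manifold.IsSmoothEmbedding 𝓘(ℝ, EuclideanSpace ℝ (Fin 2)) (𝓡 2) ∞ e₂)
    (he₁S : e₁ '' sphere 0 1 = range γ') (he₂S : e₂ '' sphere 0 1 = range γ')
    (hcov : e₁ '' closedBall 0 1 ∪ e₂ '' closedBall 0 1 = univ)
    {x₀ : sphere (0 : EuclideanSpace ℝ (Fin 3)) 1}
    (hx₀ : f x₀ = EuclideanSpace.single (0 : Fin 3) (1 : ℝ) + (-6 * s) • EuclideanSpace.single (2 : Fin 3) (1 : ℝ))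
    (hx₀e₁ : x₀ ∈ e₁ '' ball 0 1) :
    (∀ w ∈ closedBall (0 : EuclideanSpace ℝ (Fin 2)) 1,
      f (e₁ w) ∈ subSphere F P E₁ s δ ε₀ ∧
        ¬ (hsq (f (e₁ w)) < 1 + s / 2 ∧ -s ^ 2 < f (e₁ w) 2 ∧ f (e₁ w) 2 < 2 * s)) ∧
    (∀ x, x ∈ subSphere F P E₁ s δ ε₀ → ¬ (hsq x < 1 + s / 2 ∧ -s ^ 2 < x 2 ∧ x 2 < 2 * s) →
      ∃ w ∈ closedBall (0 : EuclideanSpace ℝ (Fin 2)) 1, f (e₁ w) = x) := by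
  obtain ⟨hs, hs1, hsw, hsη, hδ, hδs⟩ := scales hS
  have hfinj : Injective f := hf.isEmbedding.injective
  have hfc : Continuous f := hf.contMDiff.continuous
  have he₁c : Continuous e₁ := he₁.contMDiff.continuous
  have he₂c : Continuous e₂ := he₂.contMDiff.continuous
  have he₁inj : Injective e₁ := he₁.isEmbedding.injective
  have he₂inj : Injective e₂ := he₂.isEmbedding.injective
  -- membership in `D_A` and in `β_c`, as predicates
  have hDAmem : ∀ x, (x ∈ subSphere F P E₁ s δ ε₀ ∧ ¬ (hsq x < 1 + s / 2 ∧ -s ^ 2 < x 2 ∧ x 2 < 2 * s)) →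
      x ∈ range f := by
    rintro x ⟨hxW, hxV⟩; exact hZ₂ x (fillFun_eq_zero_of_mem_diff hP hN hS hxW hxV) (hTW x hxW)
  have hβc_DA : ∀ x, topFun s x = 0 ∧ hsq x = 1 + s / 2 →
      x ∈ subSphere F P E₁ s δ ε₀ ∧ ¬ (hsq x < 1 + s / 2 ∧ -s ^ 2 < x 2 ∧ x 2 < 2 * s) :=
    fun x hx => circle_subset hP hN hS hx.1 hx.2
  -- `f ⁻¹' βc = range γ'`
  have hpreβ : ∀ y, (topFun s (f y) = 0 ∧ hsq (f y) = 1 + s / 2) ↔ y ∈ range γ' := by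
    intro y
    have : (topFun s (f y) = 0 ∧ hsq (f y) = 1 + s / 2) ↔ f y ∈ range (f ∘ γ') := by
      rw [hfγ']; rfl
    rw [this, range_comp]
    constructor
    · rintro ⟨z, ⟨t, rfl⟩, hz⟩; exact ⟨t, hfinj hz⟩
    · rintro ⟨t, rfl⟩; exact ⟨γ' t, ⟨t, rfl⟩, rfl⟩
  -- the two open sets of `𝕊²`
  set D'' : Set (sphere (0 : EuclideanSpace ℝ (Fin 3)) 1) :=
    {y | (f y ∈ subSphere F P E₁ s δ ε₀ ∧ ¬ (hsq (f y) < 1 + s / 2 ∧ -s ^ 2 < f y 2 ∧ f y 2 < 2 * s)) ∧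
      ¬ (topFun s (f y) = 0 ∧ hsq (f y) = 1 + s / 2)} with hD''
  set B'' : Set (sphere (0 : EuclideanSpace ℝ (Fin 3)) 1) :=
    {y | ¬ (f y ∈ subSphere F P E₁ s δ ε₀ ∧ ¬ (hsq (f y) < 1 + s / 2 ∧ -s ^ 2 < f y 2 ∧ f y 2 < 2 * s))}
    with hB''
  have hB''o : IsOpen B'' := ((isClosed_subSphere_diff hP hN hS).preimage hfc).isOpen_compl
  have hβc_closed : IsClosed {x : EuclideanSpace ℝ (Fin 3) | topFun s x = 0 ∧ hsq x = 1 + s / 2} := by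
    rw [← hfγ']
    exact (isCompact_range (hfc.comp hγ'.contMDiff.continuous)).isClosed
  have hD''o : IsOpen D'' := by
    rw [isOpen_iff_mem_nhds]
    rintro y ⟨hyDA, hyβ⟩
    obtain ⟨N₁, hN₁, hN₁W⟩ := exists_mem_nhds_fillFun_zero_subset hP hN hS hyDA.1 hyDA.2
    obtain ⟨N₂, hN₂, hN₂V⟩ := exists_mem_nhds_not_V hP hN hS hyDA.1 hyDA.2 hyβ
    have hN₃ : {x : EuclideanSpace ℝ (Fin 3) | topFun s x = 0 ∧ hsq x = 1 + s / 2}ᶜ ∈ 𝓝 (f y) :=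
      hβc_closed.isOpen_compl.mem_nhds hyβ
    have hpre : f ⁻¹' (N₁ ∩ N₂ ∩ {x : EuclideanSpace ℝ (Fin 3) | topFun s x = 0 ∧ hsq x = 1 + s / 2}ᶜ) ∈ 𝓝 y :=
      hfc.continuousAt.preimage_mem_nhds (Filter.inter_mem (Filter.inter_mem hN₁ hN₂) hN₃)
    filter_upwards [hpre] with y' hy'
    obtain ⟨⟨h1, h2⟩, h3⟩ := hy'
    exact ⟨⟨hN₁W _ h1 (hZ₁ y'), hN₂V _ h2⟩, h3⟩
  have hDB : ∀ y, y ∉ range γ' → y ∈ D'' ∨ y ∈ B'' := by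
    intro y hy
    by_cases hyD : f y ∈ subSphere F P E₁ s δ ε₀ ∧ ¬ (hsq (f y) < 1 + s / 2 ∧ -s ^ 2 < f y 2 ∧ f y 2 < 2 * s)
    · exact Or.inl ⟨hyD, fun hβ => hy ((hpreβ y).1 hβ)⟩
    · exact Or.inr hyD
  have hDBdisj : ∀ y, y ∈ D'' → y ∈ B'' → False := fun y hD hB => hB hD.1
  have hballγ : ∀ {e : EuclideanSpace ℝ (Fin 2) → sphere (0 : EuclideanSpace ℝ (Fin 3)) 1},
      Injective e → e '' sphere 0 1 = range γ' →
        ∀ y ∈ e '' ball (0 : EuclideanSpace ℝ (Fin 2)) 1, y ∉ range γ' := by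
    intro e heinj heS y ⟨w, hw, hwy⟩ hyγ
    rw [← heS] at hyγ
    obtain ⟨w', hw', hw'y⟩ := hyγ
    have : w' = w := heinj (hw'y.trans hwy.symm)
    rw [this] at hw'
    rw [mem_ball_zero_iff] at hw
    rw [mem_sphere_zero_iff_norm] at hw'
    linarith
  have hU₁pre : IsPreconnected (e₁ '' ball (0 : EuclideanSpace ℝ (Fin 2)) 1) :=
    ((convex_ball (0 : EuclideanSpace ℝ (Fin 2)) 1).isPreconnected).image _ he₁c.continuousOn
  have hU₂pre : IsPreconnected (e₂ '' ball (0 : EuclideanSpace ℝ (Fin 2)) 1) :=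
    ((convex_ball (0 : EuclideanSpace ℝ (Fin 2)) 1).isPreconnected).image _ he₂c.continuousOn
  -- the lower wall point gives `x₀ ∈ D''`
  obtain ⟨-, hq₆W, hq₆V, hq₆c⟩ := lowerWallPoint hP hN hS
  have hx₀D : x₀ ∈ D'' := ⟨by rw [hx₀]; exact ⟨hq₆W, hq₆V⟩, by rw [hx₀]; exact hq₆c⟩
  have hU₁sub : e₁ '' ball (0 : EuclideanSpace ℝ (Fin 2)) 1 ⊆ D'' := by
    intro y hy
    by_contra hyD
    have hyB : y ∈ B'' := (hDB y (hballγ he₁inj he₁S y hy)).resolve_left hyD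
    have hcover : e₁ '' ball (0 : EuclideanSpace ℝ (Fin 2)) 1 ⊆ D'' ∪ B'' := fun z hz =>
      hDB z (hballγ he₁inj he₁S z hz)
    obtain ⟨z, -, hzD, hzB⟩ := hU₁pre D'' B'' hD''o hB''o hcover ⟨x₀, hx₀e₁, hx₀D⟩ ⟨y, hy, hyB⟩
    exact hDBdisj z hzD hzB
  -- the upper wall point gives a point of `U₂ ∩ B''`
  obtain ⟨huF, huW⟩ := upperWallPoint hP hN hS
  have huZ : EuclideanSpace.single (0 : Fin 3) (1 : ℝ) + s • EuclideanSpace.single (2 : Fin 3) (1 : ℝ) ∈ range f :=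
    hZ₂ _ huF hTu
  obtain ⟨yu, hyu⟩ := huZ
  have hyuB : yu ∈ B'' := fun hD => huW (by rw [← hyu]; exact hD.1)
  have hyuγ : yu ∉ range γ' := fun hyγ' => by
    have := (hpreβ yu).2 hyγ'
    rw [hyu] at this
    exact upperWallPoint_not_circle hS this
  have hcovC : ∀ y, y ∉ range γ' → y ∈ e₁ '' ball (0 : EuclideanSpace ℝ (Fin 2)) 1 ∨
      y ∈ e₂ '' ball (0 : EuclideanSpace ℝ (Fin 2)) 1 := by
    intro y hy
    have : y ∈ e₁ '' closedBall 0 1 ∪ e₂ '' closedBall 0 1 := by rw [hcov]; exact mem_univ y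
    rcases this with ⟨w, hw, rfl⟩ | ⟨w, hw, rfl⟩
    · left
      rw [mem_closedBall, dist_zero_right] at hw
      rcases hw.lt_or_eq with hlt | heq
      · exact ⟨w, mem_ball_zero_iff.2 hlt, rfl⟩
      · exact absurd (show e₁ w ∈ range γ' by rw [← he₁S]; exact ⟨w, mem_sphere_zero_iff_norm.2 heq, rfl⟩) hy
    · right
      rw [mem_closedBall, dist_zero_right] at hw
      rcases hw.lt_or_eq with hlt | heq
      · exact ⟨w, mem_ball_zero_iff.2 hlt, rfl⟩
      · exact absurd (show e₂ w ∈ range γ' by rw [← he₂S]; exact ⟨w, mem_sphere_zero_iff_norm.2 heq, rfl⟩) hy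
  have hyuU₂ : yu ∈ e₂ '' ball (0 : EuclideanSpace ℝ (Fin 2)) 1 := by
    rcases hcovC yu hyuγ with h1 | h2
    · exact absurd (hU₁sub h1) (fun hD => hDBdisj yu hD hyuB)
    · exact h2
  have hU₂sub : e₂ '' ball (0 : EuclideanSpace ℝ (Fin 2)) 1 ⊆ B'' := by
    intro y hy
    by_contra hyB
    have hyD : y ∈ D'' := (hDB y (hballγ he₂inj he₂S y hy)).resolve_right hyB
    have hcover : e₂ '' ball (0 : EuclideanSpace ℝ (Fin 2)) 1 ⊆ D'' ∪ B'' := fun z hz =>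
      hDB z (hballγ he₂inj he₂S z hz)
    obtain ⟨z, -, hzD, hzB⟩ := hU₂pre D'' B'' hD''o hB''o hcover ⟨y, hy, hyD⟩ ⟨yu, hyuU₂, hyuB⟩
    exact hDBdisj z hzD hzB
  have hD''eq : D'' = e₁ '' ball (0 : EuclideanSpace ℝ (Fin 2)) 1 := by
    refine Subset.antisymm (fun y hy => ?_) hU₁sub
    have hyγ : y ∉ range γ' := fun h' => hy.2 ((hpreβ y).2 h')
    rcases hcovC y hyγ with h1 | h2
    · exact h1
    · exact absurd hy (fun hD => hDBdisj y hD (hU₂sub h2))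
  constructor
  · intro w hw
    rw [mem_closedBall, dist_zero_right] at hw
    rcases hw.lt_or_eq with hlt | heq
    · have : e₁ w ∈ D'' := by rw [hD''eq]; exact ⟨w, mem_ball_zero_iff.2 hlt, rfl⟩
      exact this.1
    · have : e₁ w ∈ range γ' := by rw [← he₁S]; exact ⟨w, mem_sphere_zero_iff_norm.2 heq, rfl⟩
      exact hβc_DA _ ((hpreβ _).2 this)
  · intro x hxW hxV
    obtain ⟨y, rfl⟩ := hDAmem x ⟨hxW, hxV⟩
    by_cases hyγ : y ∈ range γ'
    · rw [← he₁S] at hyγ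
      obtain ⟨w, hw, rfl⟩ := hyγ
      exact ⟨w, sphere_subset_closedBall hw, rfl⟩
    · have hyD : y ∈ D'' := ⟨⟨hxW, hxV⟩, fun hβ => hyγ ((hpreβ y).1 hβ)⟩
      rw [hD''eq] at hyD
      obtain ⟨w, hw, rfl⟩ := hyD
      exact ⟨w, ball_subset_closedBall hw, rfl⟩

/-- **The sub-sphere is a smoothly embedded `2`-sphere.**  Given the (filled) sphere
`f : 𝕊² → ℝ³`, a smooth embedding whose range is the boundary `{F₂ = 0}` of the filled solid
off a set `T` missing `W` and the upper wall point (`T = ∅` in case IN; in case OUT, read through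
the complement, `T` is the far auxiliary sphere), there is a smooth embedding `f_B : 𝕊² → ℝ³`
with range the sub-sphere `W`.  Proof: `W` is the regular
level of `G_B` (`isRegularLevel_subFun`), a compact smooth surface; it is covered by two smoothly
embedded closed discs meeting along the circle `β_c` — the dome disc (`exists_domeDiscEmb`) and
the disc `D_A = W ∖ V = f(e₁(𝔻²))` (`image_disc_eq`, `exists_levelDiscEmb`) — so it is a twisted
sphere, diffeomorphic to `𝕊²` (`SchoenfliesTools.nonempty_diffeomorph_sphere_two`).  This is the
smooth sphere `S₁` of the printed proof "isotoped slightly … to be smooth" (Schultens (2014), PDF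
p. 45). [cite: Schultens2014, proof of Thm. 3.2.5 (PDF p. 45)] -/
theorem exists_subsphereParam (hP : Admissible P) (hN : StepNF F E₁ E₂ w₀ η₀ ε₀) (hS : StepScale s δ w₀ η₀)
    {f : sphere (0 : EuclideanSpace ℝ (Fin 3)) 1 → EuclideanSpace ℝ (Fin 3)}
    (hf : Manifold.IsSmoothEmbedding (𝓡 2) 𝓘(ℝ, EuclideanSpace ℝ (Fin 3)) ∞ f)
    {T : Set (EuclideanSpace ℝ (Fin 3))}
    (hZ₁ : ∀ y, fillFun F P s δ ((1 + s) ^ 2 + ε₀ + 2) (f y) = 0)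
    (hZ₂ : ∀ x, fillFun F P s δ ((1 + s) ^ 2 + ε₀ + 2) x = 0 → x ∉ T → x ∈ range f)
    (hTW : ∀ x ∈ subSphere F P E₁ s δ ε₀, x ∉ T)
    (hTu : EuclideanSpace.single (0 : Fin 3) (1 : ℝ) + s • EuclideanSpace.single (2 : Fin 3) (1 : ℝ) ∉ T) :
    ∃ fB : sphere (0 : EuclideanSpace ℝ (Fin 3)) 1 → EuclideanSpace ℝ (Fin 3),
      Manifold.IsSmoothEmbedding (𝓡 2) 𝓘(ℝ, EuclideanSpace ℝ (Fin 3)) ∞ fB ∧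
      range fB = subSphere F P E₁ s δ ε₀ := by
  obtain ⟨hs, hs1, hsw, hsη, hδ, hδs⟩ := scales hS
  set h := isRegularLevel_subFun hP hN hS with hh
  haveI : CompactSpace (RegularLevel h) := by
    rw [← isCompact_univ_iff, (RegularLevel.isEmbedding_incl h).isCompact_iff, image_univ,
      RegularLevel.range_incl, Topology.IsEmbedding.subtypeVal.isCompact_iff, image_val_preimage_eq hN]
    exact isCompact_subSphere hP hN hS
  set ι : RegularLevel h → EuclideanSpace ℝ (Fin 3) := Subtype.val ∘ RegularLevel.incl h with hι
  have hιemb : Manifold.IsSmoothEmbedding (𝓡 2) 𝓘(ℝ, EuclideanSpace ℝ (Fin 3)) ∞ ι :=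
    isSmoothEmbedding_val_comp_incl h
  have hιinj : Injective ι := hιemb.isEmbedding.injective
  have hιrange : range ι = subSphere F P E₁ s δ ε₀ := by
    rw [hι, range_comp, RegularLevel.range_incl, image_val_preimage_eq hN]
  have hιmem : ∀ z, ι z ∈ subSphere F P E₁ s δ ε₀ := fun z => by rw [← hιrange]; exact mem_range_self z
  have hfinj : Injective f := hf.isEmbedding.injective
  -- the dome disc
  obtain ⟨jB, hjB, hjB_val, hjB_surj⟩ := exists_domeDiscEmb hP hN hS
  -- the circle and the two discs of `𝕊²`
  obtain ⟨γ, hγ, hγrange⟩ := exists_circleParam hs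
  have hγf : range γ ⊆ range f := by
    rw [hγrange]
    intro x hx
    obtain ⟨hW, hV⟩ := circle_subset hP hN hS hx.1 hx.2
    exact hZ₂ x (fillFun_eq_zero_of_mem_diff hP hN hS hW hV) (hTW x hW)
  obtain ⟨hq₆F, hq₆W, -, hq₆c⟩ := lowerWallPoint hP hN hS
  have hq₆Z : EuclideanSpace.single (0 : Fin 3) (1 : ℝ) + (-6 * s) • EuclideanSpace.single (2 : Fin 3) (1 : ℝ) ∈ range f :=
    hZ₂ _ hq₆F (hTW _ hq₆W)
  obtain ⟨x₀, hx₀⟩ := hq₆Z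
  have hx₀γ : f x₀ ∉ range γ := by rw [hγrange, hx₀]; exact hq₆c
  obtain ⟨γ', e₁, e₂, hγ', hfγ', he₁, he₂, he₁S, he₂S, hcov, -, -, hx₀e₁, -, -, -⟩ :=
    SphereCircleSplitting.exists_two_discs hf hγ hγf hx₀γ
  have he₁inj : Injective e₁ := he₁.isEmbedding.injective
  have hfγ'' : range (f ∘ γ') = {x | topFun s x = 0 ∧ hsq x = 1 + s / 2} := by rw [hfγ', hγrange]
  obtain ⟨himgDA, hsurjDA⟩ := image_disc_eq hP hN hS hf hZ₁ hZ₂ hTW hTu hγ' hfγ'' he₁ he₂ he₁S he₂S hcov hx₀ hx₀e₁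
  -- the lifted disc
  obtain ⟨jA, hjA_emb, hjA_val⟩ := exists_levelDiscEmb hP hN hS hf hZ₁ he₁ himgDA
  -- `f ⁻¹' βc = range γ'`
  have hpreβ : ∀ y, (topFun s (f y) = 0 ∧ hsq (f y) = 1 + s / 2) ↔ y ∈ range γ' := by
    intro y
    have : (topFun s (f y) = 0 ∧ hsq (f y) = 1 + s / 2) ↔ f y ∈ range (f ∘ γ') := by
      rw [hfγ'']; rfl
    rw [this, range_comp]
    constructor
    · rintro ⟨z, ⟨t, rfl⟩, hz⟩; exact ⟨t, hfinj hz⟩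
    · rintro ⟨t, rfl⟩; exact ⟨γ' t, ⟨t, rfl⟩, rfl⟩
  -- the three conditions of the twisted-sphere lemma
  have hcover' : range jA ∪ range jB = univ := by
    refine eq_univ_of_forall fun z => ?_
    have hzW : ι z ∈ subSphere F P E₁ s δ ε₀ := hιmem z
    by_cases hzV : hsq (ι z) < 1 + s / 2 ∧ -s ^ 2 < ι z 2 ∧ ι z 2 < 2 * s
    · right
      obtain ⟨ha, h1⟩ := (mem_subSphere_inter_iff hP hN hS (ι z)).1 ⟨hzW, hzV⟩
      obtain ⟨b, hb⟩ := hjB_surj (ι z) ha h1.le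
      exact ⟨b, hιinj hb⟩
    · left
      obtain ⟨w, hw, hwz⟩ := hsurjDA (ι z) hzW hzV
      refine ⟨⟨w, hw⟩, hιinj ?_⟩
      show Subtype.val (RegularLevel.incl h (jA ⟨w, hw⟩)) = ι z
      rw [hjA_val]; exact hwz
  have hAB : ∀ a b, jA a = jB b →
      ‖(a : EuclideanSpace ℝ (Fin 2))‖ = 1 ∧ ‖(b : EuclideanSpace ℝ (Fin 2))‖ = 1 := by
    intro a b hab
    have hx : ι (jA a) = ι (jB b) := by rw [hab]
    obtain ⟨ha0, hhsqb⟩ := hjB_val b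
    have hxDA := himgDA a a.2
    have hb1 := sq_add_sq_le_one_of_mem b.2
    have hhsq_le : hsq (ι (jB b)) ≤ 1 + s / 2 := by
      show hsq (Subtype.val (RegularLevel.incl h (jB b))) ≤ _
      rw [hhsqb]; nlinarith
    have hxval : ι (jA a) = f (e₁ a) := hjA_val a
    have hcirc : hsq (ι (jB b)) = 1 + s / 2 :=
      hsq_eq_of_dome_of_not_V hS ha0 hhsq_le (by rw [← hx, hxval]; exact hxDA.2)
    have hbn : (b : EuclideanSpace ℝ (Fin 2)) 0 ^ 2 + (b : EuclideanSpace ℝ (Fin 2)) 1 ^ 2 = 1 := by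
      have : hsq (Subtype.val (RegularLevel.incl h (jB b))) = 1 + s / 2 := hcirc
      rw [hhsqb] at this; nlinarith
    refine ⟨?_, norm_eq_one_of_sq_add_sq hbn⟩
    have haβ : topFun s (f (e₁ a)) = 0 ∧ hsq (f (e₁ a)) = 1 + s / 2 := by
      rw [← hxval, hx]; exact ⟨ha0, hcirc⟩
    have : e₁ a ∈ range γ' := (hpreβ _).1 haβ
    rw [← he₁S] at this
    obtain ⟨w, hw, hwe⟩ := this
    rw [← he₁inj hwe]
    exact mem_sphere_zero_iff_norm.1 hw
  have hcirc : range (jA ∘ Set.inclusion (sphere_subset_closedBall :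
        sphere (0 : EuclideanSpace ℝ (Fin 2)) 1 ⊆ closedBall 0 1)) =
      range (jB ∘ Set.inclusion (sphere_subset_closedBall :
        sphere (0 : EuclideanSpace ℝ (Fin 2)) 1 ⊆ closedBall 0 1)) := by
    have hAimg : ∀ p : sphere (0 : EuclideanSpace ℝ (Fin 2)) 1,
        topFun s (ι (jA (Set.inclusion sphere_subset_closedBall p))) = 0 ∧
          hsq (ι (jA (Set.inclusion sphere_subset_closedBall p))) = 1 + s / 2 := by
      intro p
      have : ι (jA (Set.inclusion sphere_subset_closedBall p)) = f (e₁ p) := hjA_val _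
      rw [this]
      apply (hpreβ _).2
      rw [← he₁S]
      exact ⟨p, p.2, rfl⟩
    have hBimg : ∀ p : sphere (0 : EuclideanSpace ℝ (Fin 2)) 1,
        topFun s (ι (jB (Set.inclusion sphere_subset_closedBall p))) = 0 ∧
          hsq (ι (jB (Set.inclusion sphere_subset_closedBall p))) = 1 + s / 2 := by
      intro p
      obtain ⟨ha0, hh⟩ := hjB_val (Set.inclusion sphere_subset_closedBall p)
      refine ⟨ha0, ?_⟩
      show hsq (Subtype.val (RegularLevel.incl h (jB _))) = _
      rw [hh]
      have hp : ‖(p : EuclideanSpace ℝ (Fin 2))‖ = 1 := by simp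
      have := norm_sq_eq_add_sq (p : EuclideanSpace ℝ (Fin 2))
      rw [hp] at this
      show (1 + s / 2) * ((p : EuclideanSpace ℝ (Fin 2)) 0 ^ 2 + (p : EuclideanSpace ℝ (Fin 2)) 1 ^ 2) = 1 + s / 2
      nlinarith
    have hAsurj : ∀ x, topFun s x = 0 ∧ hsq x = 1 + s / 2 → ∃ p : sphere (0 : EuclideanSpace ℝ (Fin 2)) 1,
        ι (jA (Set.inclusion sphere_subset_closedBall p)) = x := by
      intro x hx
      have : x ∈ range (f ∘ γ') := by rw [hfγ'']; exact hx
      rw [range_comp] at this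
      obtain ⟨z, ⟨t, rfl⟩, rfl⟩ := this
      have : γ' t ∈ e₁ '' sphere 0 1 := by rw [he₁S]; exact ⟨t, rfl⟩
      obtain ⟨w, hw, hwe⟩ := this
      refine ⟨⟨w, hw⟩, ?_⟩
      rw [show ι (jA (Set.inclusion sphere_subset_closedBall ⟨w, hw⟩)) = f (e₁ w) from hjA_val _, hwe]
    have hBsurj : ∀ x, topFun s x = 0 ∧ hsq x = 1 + s / 2 → ∃ p : sphere (0 : EuclideanSpace ℝ (Fin 2)) 1,
        ι (jB (Set.inclusion sphere_subset_closedBall p)) = x := by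
      intro x hx
      obtain ⟨b, hb⟩ := hjB_surj x hx.1 hx.2.le
      obtain ⟨-, hh⟩ := hjB_val b
      rw [hb, hx.2] at hh
      have hbn : (b : EuclideanSpace ℝ (Fin 2)) 0 ^ 2 + (b : EuclideanSpace ℝ (Fin 2)) 1 ^ 2 = 1 := by nlinarith
      refine ⟨⟨b, mem_sphere_zero_iff_norm.2 (norm_eq_one_of_sq_add_sq hbn)⟩, ?_⟩
      rw [← hb]
      rfl
    ext z
    simp only [mem_range, comp_apply]
    constructor
    · rintro ⟨p, rfl⟩
      obtain ⟨p', hp'⟩ := hBsurj _ (hAimg p)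
      exact ⟨p', hιinj hp'⟩
    · rintro ⟨p, rfl⟩
      obtain ⟨p', hp'⟩ := hAsurj _ (hBimg p)
      exact ⟨p', hιinj hp'⟩
  -- the diffeomorphism with the round sphere and the embedding
  obtain ⟨Ψ⟩ := SchoenfliesTools.nonempty_diffeomorph_sphere_two hjA_emb hjB hcover' hAB hcirc
  refine ⟨ι ∘ Ψ.symm, hιemb.comp_diffeomorph Ψ.symm, ?_⟩
  rw [range_comp, show range (Ψ.symm : _ → RegularLevel h) = univ from
    eq_univ_of_forall fun z => ⟨Ψ z, Ψ.symm_apply_apply z⟩, image_univ, hιrange]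

end CappedBallLid

end Literature.Topology.FourManifolds

end
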